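import Summits.ResolutionOfSingularities.ResolutionOfSingularities.Theorems.EquisingularLiftEquisingularLiftNatTowerReachSsDefs
import HarnessLib

/-!
# [OURS · L1 W4.5(b) · EL♮ / EL♮(3)] RESIDUE HYPOTHESIS DEFS 3 — the A‴ widening's ONE named hypothesis (`IsoHypDefTowerBTriplePrime`)

res-L1-w45b-lead-2 g6 (text owner), THIRTY-THIRD registration prep (desk R24/R28: T23-A‴ «FIBRE PAIRS» at tier T3, engine word res-L1-w45b-stub-4 g11 v1.2 FINAL d02b1fbd6b6fb5d2; the compact house
style of R21″ (C): each widening = ONE def in a successor `…NatResidueHypDefs<k>` + one hypothesis name in the registered residue; p617887 / p620821 / p625534 are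
never edited). Exactly one `def`, no lemma. OURS; a NAMED HYPOTHESIS (abbreviation of a registered statement fragment), not a statement of any manuscript; AI-written,
weaker than expert review. Definition lane, `--supports stmt-ResolutionOfSingularities-20148 --as helper`.
-/

set_option linter.dupNamespace false
noncomputable section
open CategoryTheory CategoryTheory.Limits AlgebraicGeometry TopologicalSpace Topology IsLocalRing
open Literature.AlgebraicGeometry.Resolution
open AlgebraicGeometry.Scheme.IdealSheafData
namespace Summit.ResolutionOfSingularities.ResolutionOfSingularities.Cruxes.EquisingularLiftNat.Sections

/-- **`IsoHypDefTowerBTriplePrime`** — the DEF-TOWER-B‴ hypothesis of the T23-A‴ rung⁗ `stub_elnat_defTowerBTriplePrimePointResolutionThree` at level `n`: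
`IsoHypDefTowerBDoublePrimeS` (…NatResidueHypDefs2 p620821, blob #18) VERBATIM with `ReachTowerBDoublePrimeS ↦ ReachTowerBTriplePrime`
(…NatTowerReachSsDefs over …NatTowerRoundBTriplePrimeDefs: the A‴ chain at tier T3 — two member lists (model-carrying / model-less), restricted
point-step menus, full or FIBRE pairs and K-fibre rounds, the first point plane co-hosting the carrier round and every later in-carrier plane retained under the
transversality guard; engine word res-L1-w45b-stub-4 v1.2 FINAL d02b1fbd6b6fb5d2, desk R28). Used (negated) as the ONE extra hypothesis of the THIRTY-THIRD registration's isolated residue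
`stub_elnat_three_isolated_nonDefTowerBTriplePrime`. No monotonicity from blob #18 is claimed (engine word v1 §1). [OURS · L1 W4.5b · named hypothesis, no
mathematical content of its own] -/
def IsoHypDefTowerBTriplePrime (k : Type) [Field k] [IsAlgClosed k] (n : ℕ) (H : AlgebraicGeometry.Scheme.{0})
    (ι : H ⟶ (Literature.AlgebraicGeometry.Motives.projectiveSpace n k).left) : Prop :=
  ∃ (F' : AlgebraicGeometry.Scheme.{0}) (ρ' : F' ⟶ (Literature.AlgebraicGeometry.Motives.projectiveSpace n k).left) (T' : Set F'), (∀ Q : (∀ F₁ : AlgebraicGeometry.Scheme.{0}, (F₁ ⟶ (Literature.AlgebraicGeometry.Motives.projectiveSpace n k).left) → Set F₁ → Prop), Q (Literature.AlgebraicGeometry.Motives.projectiveSpace n k).left (CategoryTheory.CategoryStruct.id (Literature.AlgebraicGeometry.Motives.projectiveSpace n k).left) (Set.range ι) → (∀ (F₁ F₂ : AlgebraicGeometry.Scheme.{0}) (ρ : F₁ ⟶ (Literature.AlgebraicGeometry.Motives.projectiveSpace n k).left) (T₁ : Set F₁) (x : ↥(AlgebraicGeometry.Scheme.IdealSheafData.vanishingIdeal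 (⟨closure T₁, isClosed_closure⟩ : TopologicalSpace.Closeds F₁)).subscheme) (υ : F₂ ⟶ F₁) (hx : IsClosed ({((AlgebraicGeometry.Scheme.IdealSheafData.vanishingIdeal (⟨closure T₁, isClosed_closure⟩ : TopologicalSpace.Closeds F₁)).subschemeι x : F₁)} : Set F₁)), Q F₁ ρ T₁ → ¬ IsRegularLocalRing ((AlgebraicGeometry.Scheme.IdealSheafData.vanishingIdeal (⟨closure T₁, isClosed_closure⟩ : TopologicalSpace.Closeds F₁)).subscheme.presheaf.stalk x) → IsRegularLocalRing (F₁.presheaf.stalk ((AlgebraicGeometry.Scheme.IdealSheafData.vanishingIdeal (⟨closure T₁, isClosed_closure⟩ : TopologicalSpace.Closeds F₁)).subschemeι x)) → Literature.AlgebraicGeometry.Resolution.IsBlowup υ (AlgebraicGeometry.Scheme.IdealSheafData.vanishingIdeal (⟨{((AlgebraicGeometry.Scheme.IdealSheafData.vanishingIdeal (⟨closure T₁, isClosed_closure⟩ : TopologicalSpace.Closeds F₁)).subschemeι x : F₁)}, hx⟩ : TopologicalSpace.Closeds F₁)) → Q F₂ (CategoryTheory.CategoryStruct.comp υ ρ)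 (closure (υ ⁻¹' (T₁ \ {((AlgebraicGeometry.Scheme.IdealSheafData.vanishingIdeal (⟨closure T₁, isClosed_closure⟩ : TopologicalSpace.Closeds F₁)).subschemeι x : F₁)}))) ∧ (∀ (F₉ : AlgebraicGeometry.Scheme.{0}) (β : F₉ ⟶ F₂) (T₉ : Set F₉), ReachTowerBTriplePrime F₁ F₂ υ ((AlgebraicGeometry.Scheme.IdealSheafData.vanishingIdeal (⟨closure T₁, isClosed_closure⟩ : TopologicalSpace.Closeds F₁)).subschemeι x) (closure (υ ⁻¹' (T₁ \ {((AlgebraicGeometry.Scheme.IdealSheafData.vanishingIdeal (⟨closure T₁, isClosed_closure⟩ : TopologicalSpace.Closeds F₁)).subschemeι x : F₁)}))) F₉ β T₉ → Q F₉ (CategoryTheory.CategoryStruct.comp (CategoryTheory.CategoryStruct.comp β υ) ρ) T₉)) → Q F' ρ' T') ∧ Literature.AlgebraicGeometry.Resolution.Scheme.IsRegular (AlgebraicGeometry.Scheme.IdealSheafData.vanishingIdeal (⟨closure T', isClosed_closure⟩ : TopologicalSpace.Closeds F')).subscheme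

end Summit.ResolutionOfSingularities.ResolutionOfSingularities.Cruxes.EquisingularLiftNat.Sections

end
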